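import Summits.CriticalPhenomena.Ising3D.TaylorTableOddHeadReg
import Literature.MathematicalPhysics.QuantumFieldTheory.ConformalBootstrap3D.PointKernelArith
import Literature.Analysis.ValidatedNumerics.IntervalFunctions
import Mathlib.Tactic.Linarith
import Mathlib.Tactic.Positivity
import Mathlib.Tactic.Ring
import HarnessLib

/-!
# The TABLE layer of a derivative certificate, XI: interval recursion for the REGULARISED Dolan–Osborn array on a box
(cell `pub-ising3x`, seat boot-1 gen 6; gate (g2) — the odd coefficient enclosures, all three families and down to the
unitarity bound, from finite rational data)

HONEST FRAMING: lottery ticket; floor = tightest certified 3D Ising CFT bounds; no exact-solution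
claim without a proof.

The odd head terms of a kind-`deriv` table need rational enclosures of the REGULARISED coefficients
`R_{n,j}(a,b;Δ,ℓ) := (Δ - b_ℓ) · A_{n,j}(a,b;Δ,ℓ)` (`b_ℓ = unitarityBound3D ℓ`; `A = hrCoeffAB a b Δ ℓ n j`,
Dolan–Osborn 2004 eq. (3.12)) uniformly for `Δ` in a cell `[Δ₁, Δ₂]` that may START AT THE BOUND and for
`(a, b)` in a box (the three families `(t/2,t/2)`, `(-t/2,-t/2)`, `(-t/2,t/2)`, `t = Δσ - Δε` over `Q`; the signed
family has sign-indefinite weights, so no monotone shortcut is used). `R` obeys the SAME linear recursion as `A`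
(`R_{n+1,j} = (γ⁺ R_{n,j-1} + γ⁻ R_{n,j+1}) / pivot`) wherever the pivot is non-zero; the single pole entry
(`(1, ℓ-1)` for `ℓ ≥ 1`, `(2, 0)` for `ℓ = 0`, pivot `∝ Δ - b_ℓ`) is taken in CLOSED FORM with the pole cancelled
(`R_{1,ℓ-1} = (Δ-ℓ-1+2a)(Δ-ℓ-1+2b) ℓ / (2(2ℓ+1))`, `R_{2,0} = (Δ-1+2a)(Δ-1+2b)(Δ+2a)(Δ+2b)/(24Δ)`). The tables
`regABI B ℓ n j : NonemptyInterval ℚ` run this recursion in rational interval arithmetic (Moore products, exact sums,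
reciprocal of the positive pivot interval; off the descendant range the exact value `0`); `regAB_mem`: for
`B.ok ℓ nF = true` (box well-formed, cell starts at or above the bound, every in-range non-pole pivot up to level
`nF` positive at `Δ₁`) every `R_{n,j}`, `n ≤ nF`, lies in its table interval for all `(a, b, Δ)` in the box with
`b_ℓ < Δ`. With `oddHead_nonneg_of_kdCheck_reg` this makes the odd enclosures of a table DECIDABLE (per-entry
check `regEnclOK`). Sources: Dolan–Osborn 2004 §3 eqs. (3.11)–(3.13); Moore 1966 (interval arithmetic). Elementary.
-/

namespace Summit.CriticalPhenomena.Ising3D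

open Finset Set NonemptyInterval
open Literature.MathematicalPhysics.QuantumFieldTheory.ConformalBootstrap3D
open Literature.MathematicalPhysics.QuantumFieldTheory.ConformalBootstrap3D.PointKernel (casimirPivotQ cast_casimirPivotQ)
open Literature.Analysis.ValidatedNumerics

/-! ### Small interval toolkit over `ℚ` (total functions) -/

/-- The interval `[min lo hi, max lo hi]` (total). [folklore] -/
def mkI (lo hi : ℚ) : NonemptyInterval ℚ := ⟨(min lo hi, max lo hi), min_le_max⟩

/-- Membership in `mkI` from real bounds. [folklore] -/
theorem mem_mkI {lo hi : ℚ} {x : ℝ} (h1 : (lo : ℝ) ≤ x) (h2 : x ≤ hi) : x ∈ (mkI lo hi).ratCast ℝ := by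
  rw [mem_ratCast_iff]
  refine ⟨?_, ?_⟩
  · show ((min lo hi : ℚ) : ℝ) ≤ x
    push_cast; exact (min_le_left _ _).trans h1
  · show x ≤ ((max lo hi : ℚ) : ℝ)
    push_cast; exact h2.trans (le_max_right _ _)

/-- Reciprocal of a positive interval (junk `[0,0]` if the left end is not positive). [folklore] -/
def invPosI (I : NonemptyInterval ℚ) : NonemptyInterval ℚ :=
  if h : 0 < I.fst then ⟨(I.snd⁻¹, I.fst⁻¹), inv_anti₀ h I.fst_le_snd⟩ else pure 0

/-- Membership of the reciprocal. [folklore] -/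
theorem inv_mem_invPosI {I : NonemptyInterval ℚ} {x : ℝ} (hx : x ∈ I.ratCast ℝ) (h : 0 < I.fst) :
    x⁻¹ ∈ (invPosI I).ratCast ℝ := by
  have hJ : I.invI? = some (invPosI I) := by
    unfold NonemptyInterval.invI? invPosI; rw [dif_pos h, dif_pos h]
  exact inv_mem_of_invI? hx hJ

/-- `0 ∈ pure 0` (the tree's `CBox.ratCast_mem_pure` at `q = 0`, restated to keep this file's imports inside the
bootstrap topic). [folklore] -/
theorem zero_mem_pure_zero : (0 : ℝ) ∈ (pure 0 : NonemptyInterval ℚ).ratCast ℝ := by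
  rw [ratCast_pure, Rat.cast_zero]; exact NonemptyInterval.mem_pure_self _

/-! ### The box and the weight / pivot enclosures -/

/-- A box for `(a, b, Δ)`: `a ∈ [a₁,a₂]`, `b ∈ [b₁,b₂]`, `Δ ∈ [Δ₁,Δ₂]`. [folklore] -/
structure ABBox where
  /-- box -/
  a₁ : ℚ
  /-- box -/
  a₂ : ℚ
  /-- box -/
  b₁ : ℚ
  /-- box -/
  b₂ : ℚ
  /-- cell -/
  Δ₁ : ℚ
  /-- cell -/
  Δ₂ : ℚ

/-- A real point lies in the box. [folklore] -/
def ABBox.mem (B : ABBox) (a b Δ : ℝ) : Prop :=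
  ((B.a₁ : ℝ) ≤ a ∧ a ≤ B.a₂) ∧ ((B.b₁ : ℝ) ≤ b ∧ b ≤ B.b₂) ∧ ((B.Δ₁ : ℝ) ≤ Δ ∧ Δ ≤ B.Δ₂)

/-- The unitarity bound as a rational. [folklore] -/
def bQ (ℓ : ℕ) : ℚ := if ℓ = 0 then 1 / 2 else (ℓ : ℚ) + 1

/-- [folklore] -/
theorem cast_bQ (ℓ : ℕ) : ((bQ ℓ : ℚ) : ℝ) = unitarityBound3D ℓ := by
  unfold bQ unitarityBound3D; split_ifs <;> push_cast <;> ring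

/-- Enclosure of the affine form `E + c₀ + 2x` for `E = Δ + n`, `x ∈ [x₁,x₂]`: `[Δ₁+n+c₀+2x₁, Δ₂+n+c₀+2x₂]`. [folklore] -/
def affI (Δ₁ Δ₂ : ℚ) (n : ℕ) (c₀ x₁ x₂ : ℚ) : NonemptyInterval ℚ := mkI (Δ₁ + n + c₀ + 2 * x₁) (Δ₂ + n + c₀ + 2 * x₂)

/-- [folklore] -/
theorem mem_affI {Δ₁ Δ₂ : ℚ} {n : ℕ} {c₀ x₁ x₂ : ℚ} {Δ x : ℝ} (hΔ : (Δ₁ : ℝ) ≤ Δ ∧ Δ ≤ Δ₂)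
    (hx : (x₁ : ℝ) ≤ x ∧ x ≤ x₂) : Δ + (n : ℝ) + (c₀ : ℝ) + 2 * x ∈ (affI Δ₁ Δ₂ n c₀ x₁ x₂).ratCast ℝ := by
  unfold affI; apply mem_mkI <;> push_cast <;> linarith [hΔ.1, hΔ.2, hx.1, hx.2]

/-- Enclosure of `γ⁺_{Δ+n, j}(a,b) = (Δ+n+j+2a)(Δ+n+j+2b)(j+1)/(2j+1)`. [cite: DolanOsborn2004, §3 eq. (3.11)] -/
def gammaPlusI (B : ABBox) (n j : ℕ) : NonemptyInterval ℚ :=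
  ((affI B.Δ₁ B.Δ₂ n j B.a₁ B.a₂).mooreMul (affI B.Δ₁ B.Δ₂ n j B.b₁ B.b₂)).mooreMul
    (pure (((j : ℚ) + 1) / (2 * (j : ℚ) + 1)))

/-- Enclosure of `γ⁻_{Δ+n, j}(a,b) = (Δ+n-j-1+2a)(Δ+n-j-1+2b) j/(2j+1)`. [cite: DolanOsborn2004, §3 eq. (3.11)] -/
def gammaMinusI (B : ABBox) (n j : ℕ) : NonemptyInterval ℚ :=
  ((affI B.Δ₁ B.Δ₂ n (-(j : ℚ) - 1) B.a₁ B.a₂).mooreMul (affI B.Δ₁ B.Δ₂ n (-(j : ℚ) - 1) B.b₁ B.b₂)).mooreMul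
    (pure ((j : ℚ) / (2 * (j : ℚ) + 1)))

/-- [cite: DolanOsborn2004, §3 eq. (3.11)] -/
theorem mem_gammaPlusI {B : ABBox} {a b Δ : ℝ} (h : B.mem a b Δ) (n j : ℕ) :
    hrGammaPlusAB a b (Δ + n) j ∈ (gammaPlusI B n j).ratCast ℝ := by
  have hm := isSoundFun₂_mooreMul (isSoundFun₂_mooreMul (mem_affI (n := n) (c₀ := (j : ℚ)) h.2.2 h.1)
    (mem_affI (n := n) (c₀ := (j : ℚ)) h.2.2 h.2.1))
    (show ((((j : ℚ) + 1) / (2 * (j : ℚ) + 1) : ℚ) : ℝ) ∈ (pure (((j : ℚ) + 1) / (2 * (j : ℚ) + 1)) : NonemptyInterval ℚ).ratCast ℝ by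
      rw [ratCast_pure]; exact NonemptyInterval.mem_pure_self _)
  unfold gammaPlusI
  convert hm using 1
  unfold hrGammaPlusAB; push_cast; ring

/-- [cite: DolanOsborn2004, §3 eq. (3.11)] -/
theorem mem_gammaMinusI {B : ABBox} {a b Δ : ℝ} (h : B.mem a b Δ) (n j : ℕ) :
    hrGammaMinusAB a b (Δ + n) j ∈ (gammaMinusI B n j).ratCast ℝ := by
  have hm := isSoundFun₂_mooreMul (isSoundFun₂_mooreMul (mem_affI (n := n) (c₀ := -(j : ℚ) - 1) h.2.2 h.1)
    (mem_affI (n := n) (c₀ := -(j : ℚ) - 1) h.2.2 h.2.1))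
    (show ((((j : ℚ)) / (2 * (j : ℚ) + 1) : ℚ) : ℝ) ∈ (pure ((j : ℚ) / (2 * (j : ℚ) + 1)) : NonemptyInterval ℚ).ratCast ℝ by
      rw [ratCast_pure]; exact NonemptyInterval.mem_pure_self _)
  unfold gammaMinusI
  convert hm using 1
  unfold hrGammaMinusAB; push_cast; ring

/-- The pivot interval `[p(Δ₁), p(Δ₂)]` (the pivot is non-decreasing in `Δ`). [folklore] -/
def pivotI (B : ABBox) (ℓ n j : ℕ) : NonemptyInterval ℚ := mkI (casimirPivotQ B.Δ₁ ℓ n j) (casimirPivotQ B.Δ₂ ℓ n j)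

/-- [folklore] -/
theorem mem_pivotI {B : ABBox} {a b Δ : ℝ} (h : B.mem a b Δ) (ℓ n j : ℕ) :
    casimirPivot3D Δ ℓ n j ∈ (pivotI B ℓ n j).ratCast ℝ := by
  unfold pivotI
  apply mem_mkI
  · rw [cast_casimirPivotQ]; exact casimirPivot3D_mono h.2.2.1 ℓ n j
  · rw [cast_casimirPivotQ]; exact casimirPivot3D_mono h.2.2.2 ℓ n j

/-! ### The pole entries in closed form -/

/-- The pole entry of the regularised array: `(1, ℓ-1)` for `ℓ ≥ 1`, `(2, 0)` for `ℓ = 0`. [folklore] -/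
def isPole (ℓ n j : ℕ) : Bool := (decide (1 ≤ ℓ) && decide (n = 1) && decide (j + 1 = ℓ)) || (decide (ℓ = 0) && decide (n = 2) && decide (j = 0))

/-- Closed-form enclosure of the pole entry: `ℓ ≥ 1`: `(Δ-ℓ-1+2a)(Δ-ℓ-1+2b) ℓ/(2(2ℓ+1))`;
`ℓ = 0`: `(Δ-1+2a)(Δ-1+2b)(Δ+2a)(Δ+2b)/(24Δ)`. [cite: DolanOsborn2004, §3 eq. (3.12)] -/
def poleI (B : ABBox) (ℓ : ℕ) : NonemptyInterval ℚ :=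
  if ℓ = 0 then
    ((((affI B.Δ₁ B.Δ₂ 0 (-1) B.a₁ B.a₂).mooreMul (affI B.Δ₁ B.Δ₂ 0 (-1) B.b₁ B.b₂)).mooreMul
      ((affI B.Δ₁ B.Δ₂ 0 0 B.a₁ B.a₂).mooreMul (affI B.Δ₁ B.Δ₂ 0 0 B.b₁ B.b₂))).mooreMul
      (invPosI (mkI B.Δ₁ B.Δ₂))).mooreMul (pure (1 / 24))
  else
    ((affI B.Δ₁ B.Δ₂ 0 (-(ℓ : ℚ) - 1) B.a₁ B.a₂).mooreMul (affI B.Δ₁ B.Δ₂ 0 (-(ℓ : ℚ) - 1) B.b₁ B.b₂)).mooreMul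
      (pure ((ℓ : ℚ) / (2 * (2 * (ℓ : ℚ) + 1))))

/-- **The pole entry, `ℓ ≥ 1`**: `(Δ-ℓ-1) A_{1,ℓ-1}(a,b) = (Δ-ℓ-1+2a)(Δ-ℓ-1+2b) ℓ/(2(2ℓ+1))` for `Δ ≠ ℓ+1`.
[cite: DolanOsborn2004, §3 eq. (3.12)] -/
theorem reg_pole_pos {a b Δ : ℝ} {ℓ : ℕ} (hℓ : 1 ≤ ℓ) (hΔ : Δ - (ℓ : ℝ) - 1 ≠ 0) :
    (Δ - unitarityBound3D ℓ) * hrCoeffAB a b Δ ℓ 1 (ℓ - 1) =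
      (Δ - ℓ - 1 + 2 * a) * (Δ - ℓ - 1 + 2 * b) * (ℓ : ℝ) / (2 * (2 * (ℓ : ℝ) + 1)) := by
  have hb : unitarityBound3D ℓ = (ℓ : ℝ) + 1 := by unfold unitarityBound3D; rw [if_neg (by omega)]
  rw [hb, hrCoeffAB_one_pred hℓ hΔ]
  have h2 : (2 : ℝ) * (2 * (ℓ : ℝ) + 1) ≠ 0 := by positivity
  field_simp
  ring

/-- **The pole entry, `ℓ = 0`**: `(Δ-½) A_{2,0}(a,b) = (Δ-1+2a)(Δ-1+2b)(Δ+2a)(Δ+2b)/(24Δ)` for `Δ ≠ ½`, `Δ ≠ 0`.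
[cite: DolanOsborn2004, §3 eq. (3.12)] -/
theorem reg_pole_zero {a b Δ : ℝ} (hΔ : Δ - 1 / 2 ≠ 0) (hΔ0 : Δ ≠ 0) :
    (Δ - unitarityBound3D 0) * hrCoeffAB a b Δ 0 2 0 =
      (Δ - 1 + 2 * a) * (Δ - 1 + 2 * b) * ((Δ + 2 * a) * (Δ + 2 * b)) * Δ⁻¹ * (1 / 24) := by
  have hb : unitarityBound3D 0 = 1 / 2 := by simp [unitarityBound3D]
  have h11 : hrCoeffAB a b Δ 0 1 1 = (Δ + 2 * a) * (Δ + 2 * b) / (2 * Δ) := by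
    have h := hrCoeffAB_one_succ (a := a) (b := b) (ℓ := 0) (Δ := Δ) (by simpa using hΔ0)
    simpa using h
  have hpiv : casimirPivot3D Δ 0 2 0 = 4 * (Δ - 1 / 2) := by unfold casimirPivot3D; push_cast; ring
  have hstep : hrCoeffAB a b Δ 0 2 0 = hrGammaMinusAB a b (Δ + 1) 1 * hrCoeffAB a b Δ 0 1 1 / casimirPivot3D Δ 0 2 0 := by
    rw [show (2 : ℕ) = 1 + 1 from rfl, hrCoeffAB_succ]; simp
  have key : ∀ N : ℝ, (Δ - 1 / 2) * (N / (4 * (Δ - 1 / 2))) = N / 4 := fun N => by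
    have h2 : Δ * 2 - 1 ≠ 0 := by intro h; apply hΔ; linarith
    field_simp
  rw [hb, hstep, hpiv, key, h11]
  unfold hrGammaMinusAB
  field_simp
  push_cast
  ring

/-- Membership of the pole entry in `poleI`. [cite: DolanOsborn2004, §3 eq. (3.12)] -/
theorem mem_poleI {B : ABBox} {a b Δ : ℝ} (h : B.mem a b Δ) {ℓ : ℕ} (hbΔ : unitarityBound3D ℓ < Δ)
    (hΔ₁ : bQ ℓ ≤ B.Δ₁) :
    (Δ - unitarityBound3D ℓ) * hrCoeffAB a b Δ ℓ (if ℓ = 0 then 2 else 1) (if ℓ = 0 then 0 else ℓ - 1) ∈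
      (poleI B ℓ).ratCast ℝ := by
  unfold poleI
  by_cases h0 : ℓ = 0
  · subst h0
    simp only [if_true]
    have hb : unitarityBound3D 0 = 1 / 2 := by simp [unitarityBound3D]
    have hΔpos : 0 < Δ := by rw [hb] at hbΔ; linarith
    rw [reg_pole_zero (by rw [hb] at hbΔ; linarith) hΔpos.ne']
    have hΔI : Δ ∈ (mkI B.Δ₁ B.Δ₂).ratCast ℝ := mem_mkI h.2.2.1 h.2.2.2
    have hfst : 0 < (mkI B.Δ₁ B.Δ₂).fst := by
      have : (bQ 0 : ℚ) = 1 / 2 := by simp [bQ]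
      have h12 : B.Δ₁ ≤ B.Δ₂ := by exact_mod_cast h.2.2.1.trans h.2.2.2
      show 0 < min B.Δ₁ B.Δ₂
      rw [min_eq_left h12]; rw [this] at hΔ₁; linarith
    have hm := isSoundFun₂_mooreMul (isSoundFun₂_mooreMul (isSoundFun₂_mooreMul
      (isSoundFun₂_mooreMul (mem_affI (n := 0) (c₀ := -1) h.2.2 h.1) (mem_affI (n := 0) (c₀ := -1) h.2.2 h.2.1))
      (isSoundFun₂_mooreMul (mem_affI (n := 0) (c₀ := 0) h.2.2 h.1) (mem_affI (n := 0) (c₀ := 0) h.2.2 h.2.1)))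
      (inv_mem_invPosI hΔI hfst)) (show ((1 / 24 : ℚ) : ℝ) ∈ (pure (1 / 24 : ℚ) : NonemptyInterval ℚ).ratCast ℝ by rw [ratCast_pure]; exact NonemptyInterval.mem_pure_self _)
    convert hm using 1
    push_cast; ring
  · simp only [if_neg h0]
    have hℓ : 1 ≤ ℓ := Nat.one_le_iff_ne_zero.mpr h0
    have hb : unitarityBound3D ℓ = (ℓ : ℝ) + 1 := by unfold unitarityBound3D; rw [if_neg h0]
    rw [reg_pole_pos hℓ (by rw [hb] at hbΔ; linarith)]
    have hm := isSoundFun₂_mooreMul (isSoundFun₂_mooreMul (mem_affI (n := 0) (c₀ := -(ℓ : ℚ) - 1) h.2.2 h.1)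
      (mem_affI (n := 0) (c₀ := -(ℓ : ℚ) - 1) h.2.2 h.2.1)) (show (((ℓ : ℚ) / (2 * (2 * (ℓ : ℚ) + 1)) : ℚ) : ℝ) ∈ (pure ((ℓ : ℚ) / (2 * (2 * (ℓ : ℚ) + 1))) : NonemptyInterval ℚ).ratCast ℝ by rw [ratCast_pure]; exact NonemptyInterval.mem_pure_self _)
    convert hm using 1
    push_cast; ring

/-! ### The interval recursion -/

/-- Entry `j` of a tabulated level (`pure 0` beyond the list: the exact value there). [folklore] -/
def rowGet (row : List (NonemptyInterval ℚ)) (j : ℕ) : NonemptyInterval ℚ := row.getD j (pure 0)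

/-- One generic step: off the range `0`; the pole entry in closed form; else `(γ⁺ R_{n,j-1} + γ⁻ R_{n,j+1}) · pivot⁻¹`.
[cite: DolanOsborn2004, §3 eq. (3.12)] -/
def regStepI (B : ABBox) (ℓ n : ℕ) (row : List (NonemptyInterval ℚ)) (j : ℕ) : NonemptyInterval ℚ :=
  if ¬ InDescendantRange ℓ (n + 1) j then pure 0
  else if isPole ℓ (n + 1) j then poleI B ℓ
  else
    ((if j = 0 then pure 0 else (gammaPlusI B n (j - 1)).mooreMul (rowGet row (j - 1))) +
        (gammaMinusI B n (j + 1)).mooreMul (rowGet row (j + 1))).mooreMul (invPosI (pivotI B ℓ (n + 1) j))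

/-- The levels of the regularised table (`j = 0 … ℓ + n`). [cite: DolanOsborn2004, §3 eq. (3.12)] -/
def regRowI (B : ABBox) (ℓ : ℕ) : ℕ → List (NonemptyInterval ℚ)
  | 0 => (List.range (ℓ + 1)).map fun j => if j = ℓ then mkI (B.Δ₁ - bQ ℓ) (B.Δ₂ - bQ ℓ) else pure 0
  | n + 1 => (List.range (ℓ + n + 2)).map (regStepI B ℓ n (regRowI B ℓ n))

/-- **The regularised coefficient table**: `regABI B ℓ n j ∋ (Δ - b_ℓ) A_{n,j}(a,b;Δ,ℓ)`. [cite: DolanOsborn2004, §3 eq. (3.12)] -/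
def regABI (B : ABBox) (ℓ n j : ℕ) : NonemptyInterval ℚ := rowGet (regRowI B ℓ n) j

/-- Pivot check: every in-range non-pole pivot of levels `1 … nF` is positive at `Δ₁`, and the box is admissible
(`a₁ ≤ a₂`, `b₁ ≤ b₂`, `b_ℓ ≤ Δ₁ ≤ Δ₂`). [folklore] -/
def ABBox.ok (B : ABBox) (ℓ nF : ℕ) : Bool :=
  decide (B.a₁ ≤ B.a₂) && decide (B.b₁ ≤ B.b₂) && decide (B.Δ₁ ≤ B.Δ₂) && decide (bQ ℓ ≤ B.Δ₁) &&
    (List.range nF).all fun n => (List.range (ℓ + n + 2)).all fun j =>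
      !decide (InDescendantRange ℓ (n + 1) j) || isPole ℓ (n + 1) j || decide (0 < casimirPivotQ B.Δ₁ ℓ (n + 1) j)

/-- Reading a tabulated level inside its range. [folklore] -/
theorem rowGet_map_range {f : ℕ → NonemptyInterval ℚ} {N j : ℕ} (hj : j < N) :
    rowGet ((List.range N).map f) j = f j := by
  unfold rowGet
  rw [List.getD_eq_getElem _ _ (by simpa using hj)]
  simp

/-- Reading a tabulated level beyond its range gives `pure 0`. [folklore] -/
theorem rowGet_map_range_of_le {f : ℕ → NonemptyInterval ℚ} {N j : ℕ} (hj : N ≤ j) :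
    rowGet ((List.range N).map f) j = pure 0 := by
  unfold rowGet
  rw [List.getD_eq_default _ _ (by simpa using hj)]

/-- **Soundness of the regularised interval recursion.** [cite: DolanOsborn2004, §3 eqs. (3.11)–(3.13)] -/
theorem regAB_mem {B : ABBox} {ℓ nF : ℕ} (hok : B.ok ℓ nF = true) {a b Δ : ℝ} (h : B.mem a b Δ)
    (hbΔ : unitarityBound3D ℓ < Δ) :
    ∀ n, n ≤ nF → ∀ j, (Δ - unitarityBound3D ℓ) * hrCoeffAB a b Δ ℓ n j ∈ (regABI B ℓ n j).ratCast ℝ := by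
  unfold ABBox.ok at hok
  rw [Bool.and_eq_true] at hok
  obtain ⟨hok, hpiv⟩ := hok
  rw [Bool.and_eq_true, decide_eq_true_iff] at hok
  obtain ⟨_, hbΔ₁⟩ := hok
  rw [List.all_eq_true] at hpiv
  intro n
  induction n with
  | zero =>
    intro _ j
    unfold regABI regRowI
    by_cases hj : j < ℓ + 1
    · rw [rowGet_map_range hj]
      by_cases hjℓ : j = ℓ
      · subst hjℓ
        rw [if_pos rfl, hrCoeffAB_zero_self, mul_one]
        apply mem_mkI
        · push_cast; rw [cast_bQ]; linarith [h.2.2.1, h.2.2.2]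
        · push_cast; rw [cast_bQ]; linarith [h.2.2.1, h.2.2.2]
      · rw [if_neg hjℓ, hrCoeffAB_zero_of_ne a b Δ hjℓ, mul_zero]; exact zero_mem_pure_zero
    · rw [rowGet_map_range_of_le (not_lt.mp hj), hrCoeffAB_zero_of_ne a b Δ (by omega), mul_zero]
      exact zero_mem_pure_zero
  | succ n ih =>
    intro hn j
    have ihn := ih (Nat.le_of_succ_le hn)
    unfold regABI regRowI
    by_cases hj : j < ℓ + n + 2
    · rw [rowGet_map_range hj]
      unfold regStepI
      by_cases hr : InDescendantRange ℓ (n + 1) j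
      · rw [if_neg (not_not.mpr hr)]
        by_cases hp : isPole ℓ (n + 1) j = true
        · rw [if_pos hp]
          -- the pole entry
          simp only [isPole, Bool.or_eq_true, Bool.and_eq_true, decide_eq_true_eq] at hp
          have hm := mem_poleI h hbΔ hbΔ₁
          rcases hp with ⟨⟨h1ℓ, hn1⟩, hjℓ⟩ | ⟨⟨hℓ0, hn2⟩, hj0⟩
          · have hℓ0 : ℓ ≠ 0 := by omega
            rw [if_neg hℓ0, if_neg hℓ0] at hm
            have : n + 1 = 1 := hn1
            rw [this, show j = ℓ - 1 by omega]; exact hm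
          · subst hℓ0
            simp only [if_true] at hm
            have : n + 1 = 2 := hn2
            rw [this, hj0]; exact hm
        · rw [if_neg hp]
          -- generic entry: pivot positive at Δ₁
          have hpv : 0 < casimirPivotQ B.Δ₁ ℓ (n + 1) j := by
            have h1 := hpiv n (List.mem_range.mpr (by omega))
            rw [List.all_eq_true] at h1
            have h2 := h1 j (List.mem_range.mpr hj)
            rw [Bool.or_eq_true, Bool.or_eq_true, Bool.not_eq_true', decide_eq_false_iff_not,
              decide_eq_true_iff] at h2
            rcases h2 with (h' | h') | h'
            · exact absurd hr h'
            · exact absurd h' hp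
            · exact h'
          have hpΔ : 0 < casimirPivot3D Δ ℓ (n + 1) j := by
            have h0 : (0 : ℝ) < casimirPivot3D (B.Δ₁ : ℝ) ℓ (n + 1) j := by
              rw [← cast_casimirPivotQ]; exact_mod_cast hpv
            exact lt_of_lt_of_le h0 (casimirPivot3D_mono h.2.2.1 ℓ (n + 1) j)
          -- the recursion for R
          have hrec : (Δ - unitarityBound3D ℓ) * hrCoeffAB a b Δ ℓ (n + 1) j =
              ((if j = 0 then 0 else hrGammaPlusAB a b (Δ + n) (j - 1) * ((Δ - unitarityBound3D ℓ) * hrCoeffAB a b Δ ℓ n (j - 1))) +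
                hrGammaMinusAB a b (Δ + n) (j + 1) * ((Δ - unitarityBound3D ℓ) * hrCoeffAB a b Δ ℓ n (j + 1))) *
                (casimirPivot3D Δ ℓ (n + 1) j)⁻¹ := by
            rw [hrCoeffAB_succ]
            split_ifs
            · field_simp
              ring
            · field_simp
          rw [hrec]
          have hP : (casimirPivot3D Δ ℓ (n + 1) j)⁻¹ ∈ (invPosI (pivotI B ℓ (n + 1) j)).ratCast ℝ := by
            refine inv_mem_invPosI (mem_pivotI h ℓ (n + 1) j) ?_
            show 0 < min (casimirPivotQ B.Δ₁ ℓ (n + 1) j) (casimirPivotQ B.Δ₂ ℓ (n + 1) j)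
            have hmono : casimirPivotQ B.Δ₁ ℓ (n + 1) j ≤ casimirPivotQ B.Δ₂ ℓ (n + 1) j := by
              have := casimirPivot3D_mono (show ((B.Δ₁ : ℚ) : ℝ) ≤ B.Δ₂ from h.2.2.1.trans h.2.2.2) ℓ (n + 1) j
              rw [← cast_casimirPivotQ, ← cast_casimirPivotQ] at this; exact_mod_cast this
            rw [min_eq_left hmono]; exact hpv
          refine isSoundFun₂_mooreMul (isSoundFun₂_add ?_ ?_) hP
          · split_ifs with hj0
            · exact zero_mem_pure_zero
            · exact isSoundFun₂_mooreMul (mem_gammaPlusI h n (j - 1)) (ihn (j - 1))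
          · exact isSoundFun₂_mooreMul (mem_gammaMinusI h n (j + 1)) (ihn (j + 1))
      · rw [if_pos hr, hrCoeffAB_eq_zero_of_not_inDescendantRange a b Δ hr, mul_zero]
        exact zero_mem_pure_zero
    · rw [rowGet_map_range_of_le (not_lt.mp hj), hrCoeffAB_eq_zero_of_lt a b Δ (by omega), mul_zero]
      exact zero_mem_pure_zero

/-! ### The decidable per-entry check for the odd enclosures of a table -/

/-- Per-entry check: the claimed interval `I` contains the table interval `regABI B ℓ n j` (hence the regularised
coefficient) — `B` built from the cell `[lo, hi]` and the `(a, b)` ranges of the family. [folklore] -/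
def regEnclOK (B : ABBox) (ℓ nF : ℕ) (q : ℕ × ℕ) (I : ℚ × ℚ) : Bool :=
  B.ok ℓ nF && decide (q.1 ≤ nF) && decide (I.1 ≤ (regABI B ℓ q.1 q.2).fst) && decide ((regABI B ℓ q.1 q.2).snd ≤ I.2)

/-- **Soundness of `regEnclOK`.** [cite: DolanOsborn2004, §3 eq. (3.12)] -/
theorem regEnclOK_sound {B : ABBox} {ℓ nF : ℕ} {q : ℕ × ℕ} {I : ℚ × ℚ} (hc : regEnclOK B ℓ nF q I = true)
    {a b Δ : ℝ} (h : B.mem a b Δ) (hbΔ : unitarityBound3D ℓ < Δ) :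
    (I.1 : ℝ) ≤ (Δ - unitarityBound3D ℓ) * hrCoeffAB a b Δ ℓ q.1 q.2 ∧
      (Δ - unitarityBound3D ℓ) * hrCoeffAB a b Δ ℓ q.1 q.2 ≤ (I.2 : ℝ) := by
  simp only [regEnclOK, Bool.and_eq_true, decide_eq_true_eq] at hc
  obtain ⟨⟨⟨hok, hn⟩, hL⟩, hU⟩ := hc
  have hm := regAB_mem hok h hbΔ q.1 hn q.2
  rw [mem_ratCast_iff] at hm
  exact ⟨le_trans (by exact_mod_cast hL) hm.1, hm.2.trans (by exact_mod_cast hU)⟩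

/-! ### Kernel smoke test -/

/-- A signed-family box at spin `1` whose cell STARTS AT THE BOUND: `a ∈ [-9/20, -11/25]`, `b ∈ [11/25, 9/20]`,
`Δ ∈ [2, 21/10]`. [folklore] -/
def smokeABBox : ABBox := ⟨-9 / 20, -11 / 25, 11 / 25, 9 / 20, 2, 21 / 10⟩

/-- The pivot/box check passes up to level 6 (kernel). -/
example : smokeABBox.ok 1 6 = true := by decide +kernel

/-- The level-3 entry `(3, 2)` is a genuine interval (kernel evaluation of the recursion incl. the pole entry). -/
example : (regABI smokeABBox 1 3 2).fst ≤ (regABI smokeABBox 1 3 2).snd := by decide +kernel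

end Summit.CriticalPhenomena.Ising3D
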